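import Summits.ValiantsHypothesis.ValiantsHypothesis.Theses.ScaledPencil
import Summits.ValiantsHypothesis.ValiantsHypothesis.Theorems.ScaledPencilPencilOfAffine
import Summits.ValiantsHypothesis.ValiantsHypothesis.Theorems.ScaledPencilScaledSameSize
import Summits.ValiantsHypothesis.ValiantsHypothesis.Theorems.ScaledPencilMinimalRepStable

/-!
# Route ScaledPencil — the crux `NormalForm` (stmt-ValiantsHypothesis-5317) is PROVED, by its typed
# split `PencilOfAffine → ScaledSameSize → MinimalRepStable → NormalForm` (glue item
# `NormalFormOfSubs`, stmt-ValiantsHypothesis-17832)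

This file lands, under `Theorems/` (prover-only, D-0016), the composition written by the
crux-strategist (`Cruxes/NormalForm/Lines/support_split.lean`, unit `cstrat-stmt-ValiantsHypothesis-5317-r1`,
candidate proof attached to both items since 2026-08-17): the three pieces of the split ARE route
items and are all PROVED in the tree —
* `PencilOfAffine` (stmt-5322): `Summit.ValiantsHypothesis.ValiantsHypothesis.Theorems.pencilOfAffine_proof`
  — bookkeeping `HasDetRepr per_n m ↔ ∃ pencil (Λ, L) of size m`;
* `ScaledSameSize` (stmt-5320): `Summit.ValiantsHypothesis.Theorems.scaledSameSize_proof` — the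
  analytic half (Kempf–Ness first-order condition on the closed fibre `{det = per_n}`): a pencil
  computing `per_n` has an operator-scaled, torus-balanced pencil of the SAME size;
* `MinimalRepStable` (stmt-5321): `Summit.ValiantsHypothesis.ValiantsHypothesis.Theorems.minimalRepStable_proof`
  — the algebraic half: at minimal size every pencil computing `per_n` is θ-stable;
so the composition closes the crux: `normalForm_proof : Theses.ScaledPencil.NormalForm`.

Proof of the composition (`normalForm_of_subs`, 17 lines, verbatim from the line file): descend to the
minimal size `m₀ = Nat.find (∃ k, HasDetRepr per_n k) ≤ m`, take a pencil there (`PencilOfAffine`),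
rescale it at the same size (`ScaledSameSize`; minimality preserved), read off stability from
minimality (`MinimalRepStable`). The glue item `NormalFormOfSubs` spells the three antecedents out
verbatim, so it is closed by the same term (`normalFormOfSubs_proof`, defeq).

Honest framing: `NormalForm` is a normal-form / structure theorem for determinantal representations of
the permanent (every affine representation can be replaced by a not larger one that is scaled,
balanced and θ-stable); it carries NO size lower bound — the route's lower-bound cruxes
`ScaledPencilSuperquadratic`, `ScaledPencilSuperpolynomial`, `ScaledPencilNoQP` remain open, and
nothing here is progress on `VP ≠ VNP`. References: Kempf–Ness 1979; King 1994 (θ-stability); the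
tree files named above.
-/

set_option linter.dupNamespace false

namespace Summit.ValiantsHypothesis.ValiantsHypothesis.Theorems.ScaledPencilNormalFormSplit

open Literature.Computability.AlgebraicComplexity
open Summit.ValiantsHypothesis.ValiantsHypothesis.Theses.ScaledPencil
open Summit.ValiantsHypothesis.ValiantsHypothesis.Theorems

/-- **The split composes** (crux-strategist's `NormalForm_of`, verbatim):
`PencilOfAffine → ScaledSameSize → MinimalRepStable → NormalForm`. Minimal size via `Nat.find`,
pencil form, same-size rescaling, stability from minimality. [folklore] -/
theorem normalForm_of_subs :
    PencilOfAffine → ScaledSameSize → MinimalRepStable →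
      Summit.ValiantsHypothesis.ValiantsHypothesis.Theses.ScaledPencil.NormalForm := by
  intro hPencil hScaled hStable n m hm
  classical
  -- the minimal size of an affine determinantal representation of `per_n` (exists since `m` is one)
  have hex : ∃ k, HasDetRepr (perPoly (Fin n) ℂ) k := ⟨m, hm⟩
  obtain ⟨hm₀, hmin⟩ :
      HasDetRepr (perPoly (Fin n) ℂ) (Nat.find hex) ∧
        ∀ m' < Nat.find hex, ¬ HasDetRepr (perPoly (Fin n) ℂ) m' :=
    ⟨Nat.find_spec hex, fun m' h => Nat.find_min hex h⟩
  have hle : Nat.find hex ≤ m := Nat.find_min' hex hm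
  -- a pencil of minimal size (bookkeeping `HasDetRepr ↔ pencil`)
  obtain ⟨Λ, L, hdet⟩ := (hPencil n (Nat.find hex)).mp hm₀
  -- rescale inside the closed fibre `{det = per_n}` without changing the size (analytic half)
  obtain ⟨Λ', L', hdet', hscaled⟩ := hScaled n (Nat.find hex) Λ L hdet
  -- at minimal size the rescaled pencil is θ-stable (algebraic half); assemble
  exact ⟨Nat.find hex, hle, Λ', L', hdet', hscaled,
    hStable n (Nat.find hex) hmin Λ' L' hdet'⟩

/-- **Glue item `NormalFormOfSubs` (stmt-ValiantsHypothesis-17832), PROVED**: the item spells out the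
bodies of `PencilOfAffine`, `ScaledSameSize`, `MinimalRepStable` verbatim, so `normalForm_of_subs`
closes it definitionally. [folklore] -/
theorem normalFormOfSubs_proof :
    Summit.ValiantsHypothesis.ValiantsHypothesis.Theses.ScaledPencil.NormalFormOfSubs :=
  fun h₁ h₂ h₃ => normalForm_of_subs h₁ h₂ h₃

/-- **Crux `NormalForm` (stmt-ValiantsHypothesis-5317), PROVED**: every affine determinantal
representation of `per_n` of size `m` can be replaced by one of size `m' ≤ m` in normal form
(pencil `Λ + Σ x_v L_v` with `det = per_n` exactly; operator-scaled and torus-balanced with one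
`α > 0`; θ-stable) — the composition fed with the three proved pieces. [folklore] -/
theorem normalForm_proof :
    Summit.ValiantsHypothesis.ValiantsHypothesis.Theses.ScaledPencil.NormalForm :=
  normalForm_of_subs pencilOfAffine_proof Summit.ValiantsHypothesis.Theorems.scaledSameSize_proof
    minimalRepStable_proof

end Summit.ValiantsHypothesis.ValiantsHypothesis.Theorems.ScaledPencilNormalFormSplit
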